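import Summits.Ventures.LatticeQCDFlow.Scoring.OnePlaquetteSU3HaarBridge
import HarnessLib

/-!
# `∫_{SU(3)} |tr U|² dU = 1` (given Weyl's formula); the Fourier coefficients of `|Δ|²` and `∫∫ |tr U(θ)|² |Δ|²(θ) dθ = 6(2π)²`

HONEST FRAMING: exact (Metropolis-corrected) sampling algorithms for lattice gauge theory;
figures of merit are autocorrelation/cost numbers at stated couplings and volumes; no
continuum-physics claim.

Venture `LatticeQCDFlow` (cell pub-lqcd), sub-topic `Scoring`; FANOUT row 5 (`s0-sun-a`), GEN-16.
NEW WORK of the cell (placement rule); a companion of `OnePlaquetteSU3HaarMoments.lean` for the OTHER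
quadratic class function of the fundamental character, `|tr U|²` (on the eigen-angle torus
`3 + 2(cos(θ₁−θ₂) + cos(2θ₁+θ₂) + cos(θ₁+2θ₂))`, not a function of `Re tr U`):

* §1 `integral2_weylSU3_mul_torusMode` — **the Fourier coefficients of GEN-6's Weyl density**:
  `∫∫ |Δ|² e^{i(aθ₁+bθ₂)} = (2π)² Σ_{v<19} c_v [a_v = −a, b_v = −b]` (read off `weylSU3_eq_sum`), and the
  real form `integral2_weylSU3_mul_cos`;
* §2 `normSq_trace_su3Diag` (`|tr diag(e^{iθ₁},e^{iθ₂},e^{−i(θ₁+θ₂)})|² = 3 + 2Σ cos`) and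
  **`integral2_weylSU3_mul_normSq_trace`**: `∫_0^{2π}∫_0^{2π} |tr U(θ)|² |Δ|² dθ = 6(2π)²` (each cosine
  contributes `−2(2π)²`, the constant `18(2π)²`) — unconditional;
* §3 **`integral_haar_su3_normSq_trace`** — CONDITIONALLY on the tree's named fact
  `weylIntegralFormula_specialUnitary (Fin 3)` (Bröcker–tom Dieck IV (1.11)): `∫_{SU(3)} |tr U|² dU = 1`
  (the trivial representation occurs once in `3 ⊗ 3̄`; with `OnePlaquetteSU3HaarMoments`'
  `∫ (Re tr U)² dU = 1/2` this also gives `∫ Re((tr U)²) dU = 0`).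

Nothing is cited as a fact beyond the named hypothesis; no `def`.
-/

noncomputable section

open Real MeasureTheory Finset
open Literature.MathematicalPhysics.QuantumFieldTheory (haarProbability)
open Literature.MathematicalPhysics.QuantumLattice
open Literature.RepresentationTheory.CompactGroups

namespace Summit.Ventures.LatticeQCDFlow.Scoring

/-! ### 1. Fourier coefficients of the Weyl density -/

/-- **The Fourier coefficients of `|Δ|²`**:
`∫∫ |Δ|² e^{i(aθ₁+bθ₂)} = (2π)² Σ_{v<19} c_v [a_v = −a, b_v = −b]`. -/
theorem integral2_weylSU3_mul_torusMode (a b : ℤ) :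
    (∫ θ₁ in (0 : ℝ)..2 * π, ∫ θ₂ in (0 : ℝ)..2 * π, (weylSU3 θ₁ θ₂ : ℂ) * torusMode a b θ₁ θ₂)
      = (2 * π : ℂ) ^ 2 * ∑ v ∈ range 19,
          (if su3wA v + a = 0 ∧ su3wB v + b = 0 then (su3wC v : ℂ) else 0) := by
  have hexp : ∀ θ₁ θ₂ : ℝ, (weylSU3 θ₁ θ₂ : ℂ) * torusMode a b θ₁ θ₂
      = ∑ v ∈ range 19, (su3wC v : ℂ) * torusMode (su3wA v + a) (su3wB v + b) θ₁ θ₂ := by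
    intro θ₁ θ₂
    rw [weylSU3_eq_sum, Finset.sum_mul]
    refine sum_congr rfl fun v _ => ?_
    rw [mul_assoc, torusMode_mul]
  simp_rw [hexp]
  rw [integral2_finset_sum _ (fun v _ => by fun_prop), Finset.mul_sum]
  refine sum_congr rfl fun v _ => ?_
  rw [integral2_const_mul, integral2_torusMode]
  by_cases h : su3wA v + a = 0 ∧ su3wB v + b = 0
  · rw [if_pos h, if_pos h]; ring
  · rw [if_neg h, if_neg h]; ring

/-- `∫∫ |Δ|² cos(aθ₁ + bθ₂) = (2π)² · ½ Σ_v c_v ([a_v = −a, b_v = −b] + [a_v = a, b_v = b])`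
(real form). -/
theorem integral2_weylSU3_mul_cos (a b : ℤ) :
    (∫ θ₁ in (0 : ℝ)..2 * π, ∫ θ₂ in (0 : ℝ)..2 * π, weylSU3 θ₁ θ₂ * Real.cos (a * θ₁ + b * θ₂))
      = (2 * π) ^ 2 * ((∑ v ∈ range 19,
          ((if su3wA v + a = 0 ∧ su3wB v + b = 0 then (su3wC v : ℝ) else 0)
            + (if su3wA v + -a = 0 ∧ su3wB v + -b = 0 then (su3wC v : ℝ) else 0))) / 2) := by
  have hc : ∀ θ₁ θ₂ : ℝ, (((weylSU3 θ₁ θ₂ * Real.cos (a * θ₁ + b * θ₂) : ℝ)) : ℂ)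
      = (1 / 2 : ℂ) * ((weylSU3 θ₁ θ₂ : ℂ) * torusMode a b θ₁ θ₂
          + (weylSU3 θ₁ θ₂ : ℂ) * torusMode (-a) (-b) θ₁ θ₂) := by
    intro θ₁ θ₂
    have e1 : Complex.exp (((a * θ₁ + b * θ₂ : ℝ) : ℂ) * Complex.I) = torusMode a b θ₁ θ₂ := by
      unfold torusMode; congr 1; push_cast; ring
    have e2 : Complex.exp (-((a * θ₁ + b * θ₂ : ℝ) : ℂ) * Complex.I)
        = torusMode (-a) (-b) θ₁ θ₂ := by
      unfold torusMode; congr 1; push_cast; ring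
    rw [Complex.ofReal_mul, Complex.ofReal_cos, Complex.cos, e1, e2]
    ring
  apply Complex.ofReal_injective
  rw [← intervalIntegral.integral_ofReal]
  simp_rw [← intervalIntegral.integral_ofReal, hc]
  rw [integral2_const_mul, show (fun θ₁ : ℝ => ∫ θ₂ in (0 : ℝ)..2 * π,
      ((weylSU3 θ₁ θ₂ : ℂ) * torusMode a b θ₁ θ₂ + (weylSU3 θ₁ θ₂ : ℂ) * torusMode (-a) (-b) θ₁ θ₂))
      = fun θ₁ => ∫ θ₂ in (0 : ℝ)..2 * π,
        ((fun θ₁ θ₂ => (weylSU3 θ₁ θ₂ : ℂ) * torusMode a b θ₁ θ₂) θ₁ θ₂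
          + (fun θ₁ θ₂ => (weylSU3 θ₁ θ₂ : ℂ) * torusMode (-a) (-b) θ₁ θ₂) θ₁ θ₂) from rfl,
    integral2_add (by fun_prop) (by fun_prop), integral2_weylSU3_mul_torusMode,
    integral2_weylSU3_mul_torusMode]
  push_cast
  simp only [apply_ite Complex.ofReal, Complex.ofReal_zero, Complex.ofReal_intCast,
    Finset.sum_add_distrib]
  ring

/-! ### 2. `|tr U|²` on the torus and its integral against the Weyl density -/

/-- On the eigen-angle torus `|tr U|² = 3 + 2(cos(θ₁−θ₂) + cos(2θ₁+θ₂) + cos(θ₁+2θ₂))`. -/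
theorem normSq_trace_su3Diag (θ₁ θ₂ : ℝ) :
    Complex.normSq ((Matrix.diagonal (![Complex.exp ((θ₁ : ℂ) * Complex.I),
        Complex.exp ((θ₂ : ℂ) * Complex.I), Complex.exp (((-(θ₁ + θ₂) : ℝ) : ℂ) * Complex.I)] :
          Fin 3 → ℂ)).trace)
      = 3 + 2 * (Real.cos (θ₁ - θ₂) + Real.cos (2 * θ₁ + θ₂) + Real.cos (θ₁ + 2 * θ₂)) := by
  rw [Matrix.trace_diagonal, Fin.sum_univ_three]
  simp only [Matrix.cons_val_zero, Matrix.cons_val_one, Matrix.cons_val, Complex.normSq_apply,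
    Complex.add_re, Complex.add_im, Complex.exp_ofReal_mul_I_re, Complex.exp_ofReal_mul_I_im,
    Real.cos_neg, Real.sin_neg]
  have e1 : Real.cos (θ₁ - θ₂) = Real.cos θ₁ * Real.cos θ₂ + Real.sin θ₁ * Real.sin θ₂ :=
    Real.cos_sub _ _
  have e2 : Real.cos (2 * θ₁ + θ₂)
      = Real.cos θ₁ * Real.cos (θ₁ + θ₂) - Real.sin θ₁ * Real.sin (θ₁ + θ₂) := by
    rw [show 2 * θ₁ + θ₂ = θ₁ + (θ₁ + θ₂) by ring, Real.cos_add]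
  have e3 : Real.cos (θ₁ + 2 * θ₂)
      = Real.cos θ₂ * Real.cos (θ₁ + θ₂) - Real.sin θ₂ * Real.sin (θ₁ + θ₂) := by
    rw [show θ₁ + 2 * θ₂ = θ₂ + (θ₁ + θ₂) by ring, Real.cos_add]
  rw [e1, e2, e3]
  nlinarith [Real.sin_sq_add_cos_sq θ₁, Real.sin_sq_add_cos_sq θ₂, Real.sin_sq_add_cos_sq (θ₁ + θ₂)]

/-- **`∫_0^{2π}∫_0^{2π} |tr U(θ)|² |Δ|²(θ) dθ = 6(2π)²`** (the three cosines each integrate to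
`−2(2π)²` against `|Δ|²`, the constant to `3 · 6(2π)²`). -/
theorem integral2_weylSU3_mul_normSq_trace :
    (∫ θ₁ in (0 : ℝ)..2 * π, ∫ θ₂ in (0 : ℝ)..2 * π, weylSU3 θ₁ θ₂
        * (3 + 2 * (Real.cos (θ₁ - θ₂) + Real.cos (2 * θ₁ + θ₂) + Real.cos (θ₁ + 2 * θ₂))))
      = 6 * (2 * π) ^ 2 := by
  have h1 := integral2_weylSU3_mul_cos 1 (-1)
  have h2 := integral2_weylSU3_mul_cos 2 1
  have h3 := integral2_weylSU3_mul_cos 1 2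
  simp only [sum_range_succ, sum_range_zero, su3wA, su3wB, su3wC, Int.reduceNeg, Int.reduceAdd,
    Int.cast_one, Int.cast_neg, Int.cast_ofNat, one_mul, neg_mul] at h1 h2 h3
  norm_num at h1 h2 h3
  have hpt : ∀ θ₁ θ₂ : ℝ, weylSU3 θ₁ θ₂
        * (3 + 2 * (Real.cos (θ₁ - θ₂) + Real.cos (2 * θ₁ + θ₂) + Real.cos (θ₁ + 2 * θ₂)))
      = ((3 * weylSU3 θ₁ θ₂ + 2 * (weylSU3 θ₁ θ₂ * Real.cos (θ₁ + -θ₂)))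
          + 2 * (weylSU3 θ₁ θ₂ * Real.cos (2 * θ₁ + θ₂)))
          + 2 * (weylSU3 θ₁ θ₂ * Real.cos (θ₁ + 2 * θ₂)) := by
    intro θ₁ θ₂; rw [← sub_eq_add_neg]; ring
  simp_rw [hpt]
  rw [integral2_add (by fun_prop) (by fun_prop), integral2_add (by fun_prop) (by fun_prop),
    integral2_add (by fun_prop) (by fun_prop), integral2_const_mul, integral2_const_mul,
    integral2_const_mul, integral2_const_mul, integral2_weylSU3, h1, h2, h3]
  ring

/-! ### 3. `∫_{SU(3)} |tr U|² dU = 1` -/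

/-- **`∫_{SU(3)} |tr U|² dU = 1`** (given Weyl's formula for `SU(3)`): the fundamental
representation tensored with its dual contains the trivial representation exactly once. -/
theorem integral_haar_su3_normSq_trace (hW : weylIntegralFormula_specialUnitary (Fin 3)) :
    ∫ U, Complex.normSq
        ((U : Matrix.specialUnitaryGroup (Fin 3) ℂ) : Matrix (Fin 3) (Fin 3) ℂ).trace
        ∂(haarProbability (Matrix.specialUnitaryGroup (Fin 3) ℂ)) = 1 := by
  have hcl : ∀ h U : Matrix.specialUnitaryGroup (Fin 3) ℂ,
      (fun M : Matrix (Fin 3) (Fin 3) ℂ => Complex.normSq M.trace)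
          (((h * U * h⁻¹ : Matrix.specialUnitaryGroup (Fin 3) ℂ)) : Matrix (Fin 3) (Fin 3) ℂ)
        = (fun M : Matrix (Fin 3) (Fin 3) ℂ => Complex.normSq M.trace)
          ((U : Matrix.specialUnitaryGroup (Fin 3) ℂ) : Matrix (Fin 3) (Fin 3) ℂ) := by
    intro h U
    simp only
    congr 1
    have hh : star (h : Matrix (Fin 3) (Fin 3) ℂ) * (h : Matrix (Fin 3) (Fin 3) ℂ) = 1 :=
      Matrix.mem_unitaryGroup_iff'.mp (Matrix.specialUnitaryGroup_le_unitaryGroup h.2)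
    rw [show (((h * U * h⁻¹ : Matrix.specialUnitaryGroup (Fin 3) ℂ)) : Matrix (Fin 3) (Fin 3) ℂ)
        = (h : Matrix (Fin 3) (Fin 3) ℂ) * (U : Matrix (Fin 3) (Fin 3) ℂ)
          * star (h : Matrix (Fin 3) (Fin 3) ℂ)
        from rfl, Matrix.trace_mul_cycle, hh, one_mul]
  have h := integral_haar_su3_classFun_eq_integral2 hW (fun M => Complex.normSq M.trace)
    (Complex.continuous_normSq.comp continuous_id.matrix_trace) hcl
  simp only [normSq_trace_su3Diag] at h
  rw [h]
  have hpt : ∀ θ₁ θ₂ : ℝ,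
      (3 + 2 * (Real.cos (θ₁ - θ₂) + Real.cos (2 * θ₁ + θ₂) + Real.cos (θ₁ + 2 * θ₂))) * weylSU3 θ₁ θ₂
        = weylSU3 θ₁ θ₂
          * (3 + 2 * (Real.cos (θ₁ - θ₂) + Real.cos (2 * θ₁ + θ₂) + Real.cos (θ₁ + 2 * θ₂))) :=
    fun θ₁ θ₂ => mul_comm _ _
  simp_rw [hpt]
  rw [integral2_weylSU3_mul_normSq_trace]
  have hπ : (2 * π : ℝ) ^ 2 ≠ 0 := by positivity
  field_simp

end Summit.Ventures.LatticeQCDFlow.Scoring
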